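import Mathlib.Data.Fintype.Basic
import Mathlib.Data.Fintype.Prod
import Mathlib.Tactic.NormNum
import Mathlib.Tactic.Ring
import Mathlib.Tactic.Positivity
import HarnessLib

/-!
# Small binary floating-point formats ("minifloats"): finite value sets over `ℚ`

HONEST FRAMING (venture CertifiedArithmetic / cell `pub-lowprec`): certified error envelopes and
provably optimal rounding/accumulation schemes for low-precision formats under stated cost models;
every table by two implementations; no hardware or vendor claims. This file is the typed
SUBSTRATE: the finite value set of a binary floating-point format, exactly, over Mathlib's `ℚ`.

A binary interchange format datum is a triple (sign `S`, biased exponent code `E`, trailing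
significand `T` of width `m`); its value is `(-1)^S · 2^(E-bias) · (1 + T·2^(-m))` for `E ≥ 1`
(normal) and `(-1)^S · 2^(1-bias) · T·2^(-m)` for `E = 0` (subnormal), IEEE 754-2019 §3.4.
Every finite value is therefore an integer multiple of the QUANTUM `2^(1-bias-m)` (the least
positive subnormal); we record that integer (`MiniFloat.scaledMag`, in ℕ) and obtain the rational
value by one multiplication (`MiniFloat.toRat`). Which codes are finite differs between format
families and is captured by two parameters: the largest exponent code `emaxCode` that still carries
finite values, and the largest trailing significand `topMan` admitted together with that top code:
* IEEE-style (binary16/32, OCP `E5M2`): `emaxCode = 2^w - 2`, `topMan = 2^m - 1` (the all-ones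
  exponent code is ∞/NaN) [MicikeviciusEtAl2022, Table 1];
* OCP `E4M3` ("fn": finite, no ∞): `emaxCode = 2^w - 1 = 15`, `topMan = 2^m - 2 = 6` (only
  `S.1111.111` is NaN; max finite `448`) [MicikeviciusEtAl2022, Table 1 and §3.1];
* OCP MX element formats `E3M2`, `E2M3`, `E2M1` (no ∞, no NaN): `emaxCode = 2^w - 1`,
  `topMan = 2^m - 1` [RouhaniEtAl2023MX, §2.1–2.2 and Table 1; OCP MX v1.0 §5.3].
The concrete formats are instantiated in `Formats.lean`; rounding is in `Round.lean`.

Design choices. (1) Values live in `ℚ` (exact; `decide`-friendly), not `ℝ`/`EReal`. (2) Both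
signed zeros are kept as distinct data with the same value `0` (OCP convention; P3109 formats, which
have a single zero and a single NaN, have the same nonzero VALUE SET for matching parameters and are
out of scope here — see the Lean formalization FLoPS [ChangParkLimNagarakatte2026] for P3109
proper). (3) NaN/∞ are not data of `MiniFloat φ`: this is the type of FINITE values, which is what
error analysis quantifies over; saturation/overflow conventions are attached to the rounding maps.
(4) The binade of a scaled magnitude is computed by a structurally recursive search
(`Format.shiftAux`), never by `Nat.log2`, so that every function here reduces in the kernel.

Deliberately NOT here: rounding (file `Round.lean`), arithmetic operations, encodings to bit
strings (file `Formats.lean` gives the code ↔ datum maps for the named formats).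
-/

namespace Literature.ComputerArithmetic.FloatingPoint

/-- Parameters of a binary floating-point format seen through its FINITE values: trailing
significand width `manBits = m`, exponent `bias`, the largest biased exponent code `emaxCode`
carrying finite values (codes `0 … emaxCode`; code `0` is the subnormal binade, `emin = 1 - bias`),
and the largest trailing significand `topMan` admitted together with the top code (codes above it
are the format's NaN/∞ encodings, if any). [cite: IEEE7542019, §3.4] -/
structure Format where
  /-- width `m` of the trailing significand ("mantissa") field; precision is `p = m + 1` -/
  manBits : ℕ
  /-- exponent bias -/
  bias : ℕ
  /-- largest biased exponent code that carries finite values -/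
  emaxCode : ℕ
  /-- largest trailing significand admitted together with exponent code `emaxCode` -/
  topMan : ℕ
  /-- `topMan` is a trailing significand -/
  topMan_lt : topMan < 2 ^ manBits
  deriving DecidableEq

namespace Format

variable (φ : Format)

/-- Exponent of the quantum: the least positive subnormal of `φ` is `2 ^ qexp = 2^(emin - m)` with
`emin = 1 - bias`. [cite: IEEE7542019, §3.3] -/
def qexp : ℤ := 1 - (φ.bias : ℤ) - φ.manBits

/-- The quantum `2^(1 - bias - m)` of `φ` as a rational: every finite value is an integer multiple
of it. [cite: IEEE7542019, §3.3] -/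
def quantum : ℚ := (2 : ℚ) ^ φ.qexp

/-- Unit roundoff `u = 2^-(m+1) = 2^(-p)` of `φ`. [cite: Higham2002ASNA, §2.1 eq. (2.3)] -/
def unitRoundoff : ℚ := (2 : ℚ) ^ (-((φ.manBits : ℤ) + 1))

/-- Magnitude, in quanta, of the datum with exponent code `E` and trailing significand `T`:
`T` in the subnormal binade `E = 0`, else `(2^m + T) · 2^(E-1)`. [cite: IEEE7542019, §3.4] -/
def scaled (E T : ℕ) : ℕ :=
  if E = 0 then T else (2 ^ φ.manBits + T) * 2 ^ (E - 1)

/-- The largest finite magnitude of `φ`, in quanta. [cite: IEEE7542019, §3.3] -/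
def maxScaled : ℕ := φ.scaled φ.emaxCode φ.topMan

/-- The largest finite value of `φ` as a rational. [cite: IEEE7542019, §3.3] -/
def maxRat : ℚ := (φ.maxScaled : ℚ) * φ.quantum

/-- `scaled 0 T = T`. [folklore] -/
@[simp] theorem scaled_zero (T : ℕ) : φ.scaled 0 T = T := by simp [scaled]

/-- `scaled (E+1) T = (2^m + T) · 2^E`. [folklore] -/
@[simp] theorem scaled_succ (E T : ℕ) : φ.scaled (E + 1) T = (2 ^ φ.manBits + T) * 2 ^ E := by
  simp [scaled]

/-- The quantum is positive. [folklore] -/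
theorem quantum_pos : 0 < φ.quantum := by
  unfold quantum; exact zpow_pos (by norm_num) _

/-- The unit roundoff is positive. [folklore] -/
theorem unitRoundoff_pos : 0 < φ.unitRoundoff := by
  unfold unitRoundoff; exact zpow_pos (by norm_num) _

/-! ### Binade search (structural, kernel-reducible) -/

/-- `shiftAux m n fuel`: the number of halvings (at most `fuel`) needed to bring `n` below
`2^(m+1)`; i.e. `min fuel (bitlength n - (m+1))⁺`. Structural recursion on `fuel`. [folklore] -/
def shiftAux (m : ℕ) : ℕ → ℕ → ℕ
  | _, 0 => 0
  | n, fuel + 1 => if n < 2 ^ (m + 1) then 0 else shiftAux m (n / 2) fuel + 1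

/-- Binade shift of a magnitude of `n` quanta in format `φ`: the grid spacing of `φ` around `n`
is `2 ^ (φ.shift n)` quanta (capped at the top binade's spacing `2^(emaxCode-1)`). [folklore] -/
def shift (n : ℕ) : ℕ := shiftAux φ.manBits n (φ.emaxCode - 1)

/-- Exponent code of the datum of magnitude `n` quanta (for representable `n`). [folklore] -/
def expOf (n : ℕ) : ℕ := if n < 2 ^ φ.manBits then 0 else φ.shift n + 1

/-- Trailing significand of the datum of magnitude `n` quanta (for representable `n`).
[folklore] -/
def manOf (n : ℕ) : ℕ := if n < 2 ^ φ.manBits then n else n / 2 ^ φ.shift n - 2 ^ φ.manBits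

variable {φ}

/-- `shiftAux` never exceeds its fuel. [folklore] -/
theorem shiftAux_le (m : ℕ) : ∀ (n fuel : ℕ), shiftAux m n fuel ≤ fuel
  | _, 0 => by simp [shiftAux]
  | n, fuel + 1 => by
      simp only [shiftAux]
      split
      · exact Nat.zero_le _
      · exact Nat.succ_le_succ (shiftAux_le m (n / 2) fuel)

/-- Lower bound: if `2^m ≤ n` then `2^(m + shiftAux m n fuel) ≤ n`. [folklore] -/
theorem pow_shiftAux_le (m : ℕ) : ∀ (n fuel : ℕ), 2 ^ m ≤ n → 2 ^ (m + shiftAux m n fuel) ≤ n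
  | _, 0, h => by simpa [shiftAux] using h
  | n, fuel + 1, h => by
      simp only [shiftAux]
      split
      · simpa using h
      · rename_i hlt
        have h2 : 2 ^ m ≤ n / 2 := by
          rw [Nat.le_div_iff_mul_le (by norm_num)]
          rw [pow_succ] at hlt; omega
        have ih := pow_shiftAux_le m (n / 2) fuel h2
        calc 2 ^ (m + (shiftAux m (n / 2) fuel + 1))
            = 2 ^ (m + shiftAux m (n / 2) fuel) * 2 := by ring
          _ ≤ n / 2 * 2 := Nat.mul_le_mul_right _ ih
          _ ≤ n := Nat.div_mul_le_self n 2

/-- Upper bound: if the search stopped before exhausting its fuel then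
`n < 2^(m + 1 + shiftAux m n fuel)`. [folklore] -/
theorem lt_pow_shiftAux (m : ℕ) :
    ∀ (n fuel : ℕ), shiftAux m n fuel < fuel → n < 2 ^ (m + 1 + shiftAux m n fuel)
  | _, 0, h => by simp [shiftAux] at h
  | n, fuel + 1, h => by
      simp only [shiftAux] at h ⊢
      split
      · rename_i hlt; simpa using hlt
      · rename_i hge
        rw [if_neg hge] at h
        have ih := lt_pow_shiftAux m (n / 2) fuel (by omega)
        have : n < 2 ^ (m + 1 + shiftAux m (n / 2) fuel) * 2 := by omega
        calc n < 2 ^ (m + 1 + shiftAux m (n / 2) fuel) * 2 := this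
          _ = 2 ^ (m + 1 + (shiftAux m (n / 2) fuel + 1)) := by ring

/-- `shiftAux` is monotone in `n`. [folklore] -/
theorem shiftAux_mono (m : ℕ) : ∀ {n n' : ℕ} (fuel : ℕ), n ≤ n' →
    shiftAux m n fuel ≤ shiftAux m n' fuel
  | _, _, 0, _ => by simp [shiftAux]
  | n, n', fuel + 1, h => by
      simp only [shiftAux]
      by_cases h1 : n < 2 ^ (m + 1)
      · simp [h1]
      · have h2 : ¬ n' < 2 ^ (m + 1) := by omega
        rw [if_neg h1, if_neg h2]
        exact Nat.succ_le_succ (shiftAux_mono m fuel (Nat.div_le_div_right h))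

/-- Small magnitudes have shift `0`. [folklore] -/
theorem shiftAux_eq_zero_of_lt (m : ℕ) : ∀ {n : ℕ} (fuel : ℕ), n < 2 ^ (m + 1) →
    shiftAux m n fuel = 0
  | _, 0, _ => by simp [shiftAux]
  | n, fuel + 1, h => by simp [shiftAux, h]

/-- A multiple `k · 2^j` with `2^m ≤ k < 2^(m+1)` and `j ≤ fuel` has shift exactly `j`.
[folklore] -/
theorem shiftAux_mul_pow (m : ℕ) : ∀ (j fuel : ℕ) {k : ℕ}, 2 ^ m ≤ k → k < 2 ^ (m + 1) →
    j ≤ fuel → shiftAux m (k * 2 ^ j) fuel = j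
  | 0, fuel, k, hk, hk', _ => by
      simp only [pow_zero, mul_one]
      exact shiftAux_eq_zero_of_lt m fuel hk'
  | j + 1, fuel + 1, k, hk, hk', hj => by
      simp only [shiftAux]
      have hge : ¬ k * 2 ^ (j + 1) < 2 ^ (m + 1) := by
        have : 2 ^ m * 2 ^ 1 ≤ k * 2 ^ (j + 1) :=
          Nat.mul_le_mul hk (Nat.pow_le_pow_right (by norm_num) (by omega))
        rw [← pow_add] at this; omega
      rw [if_neg hge]
      have hdiv : k * 2 ^ (j + 1) / 2 = k * 2 ^ j := by
        rw [pow_succ, ← mul_assoc, Nat.mul_div_cancel _ (by norm_num)]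
      rw [hdiv, shiftAux_mul_pow m j fuel hk hk' (by omega)]
  | j + 1, 0, k, _, _, hj => by omega

/-- The shift never exceeds `emaxCode - 1`. [folklore] -/
theorem shift_le (n : ℕ) : φ.shift n ≤ φ.emaxCode - 1 := shiftAux_le _ _ _

/-- `2^(m + shift n) ≤ n` once `2^m ≤ n`. [folklore] -/
theorem pow_shift_le {n : ℕ} (h : 2 ^ φ.manBits ≤ n) : 2 ^ (φ.manBits + φ.shift n) ≤ n :=
  pow_shiftAux_le _ _ _ h

/-- Below the top binade, `n < 2^(m + 1 + shift n)`. [folklore] -/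
theorem lt_pow_shift {n : ℕ} (h : φ.shift n < φ.emaxCode - 1) :
    n < 2 ^ (φ.manBits + 1 + φ.shift n) :=
  lt_pow_shiftAux _ _ _ h

/-- The shift is monotone. [folklore] -/
theorem shift_mono {n n' : ℕ} (h : n ≤ n') : φ.shift n ≤ φ.shift n' := shiftAux_mono _ _ h

/-- Magnitudes below `2^(m+1)` have shift `0`. [folklore] -/
theorem shift_eq_zero_of_lt {n : ℕ} (h : n < 2 ^ (φ.manBits + 1)) : φ.shift n = 0 :=
  shiftAux_eq_zero_of_lt _ _ h

/-- The shift of a normal datum `(2^m + T) · 2^j`, `j ≤ emaxCode - 1`, is `j`. [folklore] -/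
theorem shift_scaled_succ {T j : ℕ} (hT : T < 2 ^ φ.manBits) (hj : j ≤ φ.emaxCode - 1) :
    φ.shift ((2 ^ φ.manBits + T) * 2 ^ j) = j :=
  shiftAux_mul_pow _ _ _ (by omega) (by rw [pow_succ]; omega) hj

/-! ### The largest magnitude -/

/-- `maxScaled < 2^(m + emaxCode)` when there is at least one normal binade. [folklore] -/
theorem maxScaled_lt_pow (h : 1 ≤ φ.emaxCode) :
    φ.maxScaled < 2 ^ (φ.manBits + φ.emaxCode) := by
  unfold maxScaled scaled
  rw [if_neg (by omega)]
  have ht := φ.topMan_lt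
  calc (2 ^ φ.manBits + φ.topMan) * 2 ^ (φ.emaxCode - 1)
      < (2 ^ φ.manBits + 2 ^ φ.manBits) * 2 ^ (φ.emaxCode - 1) :=
        Nat.mul_lt_mul_of_pos_right (by omega) (by positivity)
    _ = 2 ^ (φ.manBits + φ.emaxCode) := by
        rw [← two_mul, ← pow_succ', ← pow_add]; congr 1; omega

/-- With no normal binade (`emaxCode = 0`, a fixed-point format) `maxScaled = topMan < 2^m`.
[folklore] -/
theorem maxScaled_eq_topMan (h : φ.emaxCode = 0) : φ.maxScaled = φ.topMan := by
  simp [maxScaled, scaled, h]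

end Format

/-! ### The data type of finite values -/

/-- A finite datum of format `φ`: sign, biased exponent code `expCode ≤ emaxCode`, trailing
significand `man < 2^m`, with `man ≤ topMan` in the top binade. Both signed zeros are data.
[cite: IEEE7542019, §3.4] -/
structure MiniFloat (φ : Format) where
  /-- sign bit (`true` = negative) -/
  neg : Bool
  /-- biased exponent code -/
  expCode : ℕ
  /-- trailing significand -/
  man : ℕ
  /-- the exponent code carries finite values -/
  expCode_le : expCode ≤ φ.emaxCode
  /-- the trailing significand fits its field -/
  man_lt : man < 2 ^ φ.manBits
  /-- in the top binade only significands up to `topMan` are finite -/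
  man_le_top : expCode = φ.emaxCode → man ≤ φ.topMan
  deriving DecidableEq

namespace MiniFloat

variable {φ : Format}

/-- Extensionality on the three data fields. [folklore] -/
@[ext] theorem ext {x y : MiniFloat φ} (h1 : x.neg = y.neg) (h2 : x.expCode = y.expCode)
    (h3 : x.man = y.man) : x = y := by
  cases x; cases y; simp only at h1 h2 h3; subst h1 h2 h3; rfl

/-- Magnitude in quanta. [cite: IEEE7542019, §3.4] -/
def scaledMag (x : MiniFloat φ) : ℕ := φ.scaled x.expCode x.man

/-- Signed value in quanta. [cite: IEEE7542019, §3.4] -/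
def toInt (x : MiniFloat φ) : ℤ := if x.neg then -(x.scaledMag : ℤ) else x.scaledMag

/-- The rational value of a finite datum: `toInt · 2^(1 - bias - m)`. [cite: IEEE7542019, §3.4] -/
def toRat (x : MiniFloat φ) : ℚ := (x.toInt : ℚ) * φ.quantum

/-- Positive zero. [cite: IEEE7542019, §3.4] -/
def zero (φ : Format) : MiniFloat φ :=
  ⟨false, 0, 0, Nat.zero_le _, Nat.two_pow_pos _, fun _ => Nat.zero_le _⟩

/-- The largest finite datum. [cite: IEEE7542019, §3.3] -/
def top (φ : Format) : MiniFloat φ :=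
  ⟨false, φ.emaxCode, φ.topMan, le_rfl, φ.topMan_lt, fun _ => le_rfl⟩

/-- Sign flip (exact). [cite: IEEE7542019, §5.5.1] -/
def flipSign (x : MiniFloat φ) : MiniFloat φ :=
  ⟨!x.neg, x.expCode, x.man, x.expCode_le, x.man_lt, x.man_le_top⟩

/-- `zero` has value `0`. [folklore] -/
@[simp] theorem toRat_zero : (zero φ).toRat = 0 := by
  simp [toRat, toInt, zero, scaledMag]

/-- `top` has magnitude `maxScaled`. [folklore] -/
@[simp] theorem scaledMag_top : (top φ).scaledMag = φ.maxScaled := rfl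

/-- `|toInt x| = scaledMag x`. [folklore] -/
theorem natAbs_toInt (x : MiniFloat φ) : x.toInt.natAbs = x.scaledMag := by
  unfold toInt; split <;> simp

/-- `|toRat x| = scaledMag x · quantum`. [folklore] -/
theorem abs_toRat (x : MiniFloat φ) : |x.toRat| = (x.scaledMag : ℚ) * φ.quantum := by
  unfold toRat toInt
  have hq := φ.quantum_pos
  split <;> simp [abs_mul, abs_of_pos hq]

/-- `flipSign` negates the value. [folklore] -/
@[simp] theorem toRat_flipSign (x : MiniFloat φ) : x.flipSign.toRat = -x.toRat := by
  unfold flipSign toRat toInt scaledMag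
  cases x.neg <;> simp

/-- Every magnitude is at most `maxScaled`. [folklore] -/
theorem scaledMag_le_maxScaled (x : MiniFloat φ) : x.scaledMag ≤ φ.maxScaled := by
  rcases x with ⟨s, E, T, hE, hT, htop⟩
  unfold scaledMag Format.maxScaled Format.scaled
  simp only
  rcases Nat.eq_or_lt_of_le hE with rfl | hlt
  · have := htop rfl
    split <;> [exact this; exact Nat.mul_le_mul_right _ (by omega)]
  · have hem : φ.emaxCode ≠ 0 := by omega
    rw [if_neg hem]
    split
    · -- subnormal ≤ anything with a leading bit
      calc T ≤ 2 ^ φ.manBits := hT.le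
        _ ≤ (2 ^ φ.manBits + φ.topMan) * 2 ^ (φ.emaxCode - 1) := by
          calc 2 ^ φ.manBits = 2 ^ φ.manBits * 1 := (mul_one _).symm
            _ ≤ (2 ^ φ.manBits + φ.topMan) * 2 ^ (φ.emaxCode - 1) :=
              Nat.mul_le_mul (by omega) (Nat.one_le_two_pow)
    · rename_i hE0
      calc (2 ^ φ.manBits + T) * 2 ^ (E - 1)
          ≤ (2 ^ φ.manBits + 2 ^ φ.manBits) * 2 ^ (E - 1) := Nat.mul_le_mul_right _ (by omega)
        _ = 2 ^ φ.manBits * 2 ^ E := by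
          rw [← two_mul, mul_comm 2, mul_assoc, ← pow_succ']; congr 2; omega
        _ ≤ 2 ^ φ.manBits * 2 ^ (φ.emaxCode - 1) :=
          Nat.mul_le_mul_left _ (Nat.pow_le_pow_right (by norm_num) (by omega))
        _ ≤ (2 ^ φ.manBits + φ.topMan) * 2 ^ (φ.emaxCode - 1) := Nat.mul_le_mul_right _ (by omega)

/-- `|toRat x| ≤ maxRat`. [folklore] -/
theorem abs_toRat_le_maxRat (x : MiniFloat φ) : |x.toRat| ≤ φ.maxRat := by
  rw [abs_toRat]
  exact mul_le_mul_of_nonneg_right (by exact_mod_cast x.scaledMag_le_maxScaled) φ.quantum_pos.le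

/-! ### Finite enumeration -/

/-- `MiniFloat φ` is (computably) equivalent to a decidable subtype of
`Bool × Fin (emaxCode+1) × Fin (2^m)`. [folklore] -/
def equivSubtype (φ : Format) : MiniFloat φ ≃
    {p : Bool × Fin (φ.emaxCode + 1) × Fin (2 ^ φ.manBits) //
      (p.2.1 : ℕ) = φ.emaxCode → (p.2.2 : ℕ) ≤ φ.topMan} where
  toFun x := ⟨(x.neg, ⟨x.expCode, Nat.lt_succ_of_le x.expCode_le⟩, ⟨x.man, x.man_lt⟩), x.man_le_top⟩
  invFun p := ⟨p.1.1, p.1.2.1, p.1.2.2, Nat.le_of_lt_succ p.1.2.1.isLt, p.1.2.2.isLt, p.2⟩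
  left_inv x := by cases x; rfl
  right_inv p := by rcases p with ⟨⟨s, E, T⟩, h⟩; rfl

/-- The finite values of `φ` form a finite type (computable instance). [folklore] -/
instance instFintype (φ : Format) : Fintype (MiniFloat φ) :=
  Fintype.ofEquiv _ (equivSubtype φ).symm

/-- All data of `φ`, as an explicit list (exponent-major, then significand, both signs), for
kernel evaluation by `decide` and for table export. [folklore] -/
def all (φ : Format) : List (MiniFloat φ) :=
  (List.range (φ.emaxCode + 1)).flatMap fun E =>
    (List.range (2 ^ φ.manBits)).flatMap fun T =>
      if h : E ≤ φ.emaxCode ∧ T < 2 ^ φ.manBits ∧ (E = φ.emaxCode → T ≤ φ.topMan) then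
        [⟨false, E, T, h.1, h.2.1, h.2.2⟩, ⟨true, E, T, h.1, h.2.1, h.2.2⟩]
      else []

/-- The list `all φ` is exhaustive. [folklore] -/
theorem mem_all (x : MiniFloat φ) : x ∈ all φ := by
  rcases x with ⟨s, E, T, hE, hT, htop⟩
  simp only [all, List.mem_flatMap, List.mem_range]
  refine ⟨E, Nat.lt_succ_of_le hE, T, hT, ?_⟩
  rw [dif_pos ⟨hE, hT, htop⟩]
  cases s <;> simp

/-- A property checked on the list `all φ` holds for every datum. [folklore] -/
theorem forall_of_all_all {P : MiniFloat φ → Bool} (h : (all φ).all P = true) (x : MiniFloat φ) :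
    P x = true :=
  List.all_eq_true.mp h x (mem_all x)

/-- Binary version of `forall_of_all_all` (tables over pairs). [folklore] -/
theorem forall₂_of_all_all {ψ : Format} {P : MiniFloat φ → MiniFloat ψ → Bool}
    (h : ((all φ).all fun x => (all ψ).all fun y => P x y) = true) (x : MiniFloat φ)
    (y : MiniFloat ψ) : P x y = true :=
  List.all_eq_true.mp (List.all_eq_true.mp h x (mem_all x)) y (mem_all y)

end MiniFloat

end Literature.ComputerArithmetic.FloatingPoint
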